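import Literature.AnabelianGeometry.SemiGraphs.TemperedAnabelianSec6OfTowerProofs
import Literature.AnabelianGeometry.AbsoluteAnabelian.ProfiniteTerminology
import Mathlib.GroupTheory.Commensurable
import Mathlib.Topology.Algebra.Group.ClosedSubgroup
import HarnessLib

/-!
# A tempered group with a virtually free tower is commensurably terminal in its profinite completion

Mochizuki, *Semi-graphs of anabelioids*, Publ. RIMS **42** (2006) [SemiAnbd], §6 Lemma 6.3 (iii)
p. 70 ("Suppose that `F₁, F₂ ⊆ F` are subgroups of DOF-type which are dense in `F̂`. Then, for any
`f ∈ F̂` such that `f · F₁ · f⁻¹ = F₂`, it follows that `f ∈ F`"), and *Inter-universal Teichmüller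
theory I* [IUTchI], Prop. 2.4 (iii) p. 50 ("`Π^tp_X` is commensurably terminal in `Π̂_X`").
[cite: MochizukiSemiAnbd2006, Lem 6.3(iii) p.70]

PROOF-ONLY file (abc-iut cell, prover abc-iut-w5-d240; no definitions, no named facts introduced).
Over L3's interfaces `IsTempered Π` / `IsProfiniteCompletion (ι : Π → Π̂)` and the virtually free tower
input `htower₀` (cofinally many open normal `N ⊴ Π` with `Π/N ⊇` a non-abelian free normal subgroup of
finite index and finite rank, [André 2003, §4.5]):

* `IsTempered.mem_range_of_conj_eq_of_isDOFType` — Lemma 6.3 (iii) WITHOUT the density-in-`F̂`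
  hypothesis: if `F₁, F₂ ≤ Π` are of DOF-type (dense in open subgroups `U₁, U₂` of finite index) and
  `x ∈ Π̂` conjugates `ι(F₁)` onto `ι(F₂)`, then `x ∈ ι(Π)`.  Reduction to the equal-closure case
  (`IsTempered.mem_range_of_conj_eq_of_closure_eq`): `x` carries `Û₁ = cl ι(U₁)` onto `Û₂`, the
  transporter contains the open coset `x · Û₁`, which meets the dense `ι(Π)` in some `ι(p)`; then
  `ι(p)⁻¹ x` conjugates `F₁` onto `p⁻¹ F₂ p`, both dense in `U₁ = ι⁻¹(Û₁)`;
* `isDOFType_of_finiteIndex` — a subgroup of finite index of a topological group is of DOF-type (its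
  closure is a closed subgroup of finite index, hence open);
* `IsTempered.isCommensurablyTerminal_range` — **`ι(Π)` is commensurably terminal in `Π̂`**
  (`C_{Π̂}(ι Π) = ι Π`, Mathlib's `Subgroup.Commensurable.commensurator`; the tree's
  `IsCommensurablyTerminal` of [AbsAnab] Def. 0.1 (iii)): an element of the commensurator conjugates
  the finite-index subgroup `ι⁻¹(ιΠ ∩ x⁻¹ ιΠ x)` onto `ι⁻¹(ιΠ ∩ x ιΠ x⁻¹)`;
* `TemperedCurve.isCommensurablyTerminal_range_toHat_of_tower` — for a datum `X : TemperedCurve p` of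
  the [SemiAnbd] §6 interface: `Π^temp_{X_K}` is commensurably terminal in `Π_{X_K}`, modulo
  `IsTempered X.PiTemp` and `htower₀` (this is the `Π`-clause of [IUTchI] Prop. 2.4 (iii) in the §6
  vocabulary; it sharpens Lemma 6.1 (iii) `PiTempNormallyTerminal`).

Classical topological group theory; nothing here concerns the disputed parts of inter-universal
Teichmüller theory or takes a side on [IUTchIII] Cor. 3.12; typed ≠ discharged.
-/

noncomputable section

namespace Literature.AnabelianGeometry.SemiGraphs

open _root_.Topology
open scoped Pointwise
open Literature.AnabelianGeometry.EtaleTheta.DiscreteNormalizers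
open Literature.AnabelianGeometry.AbsoluteAnabelian (IsCommensurablyTerminal)

universe u v

section Generic

variable {P : Type u} [Group P] [TopologicalSpace P] [IsTopologicalGroup P]
variable {Ph : Type v} [Group Ph] [TopologicalSpace Ph] [IsTopologicalGroup Ph]

/-- A subgroup of finite index of a topological group is of DOF-type ([SemiAnbd] Def. 6.2 (ii)): it
is dense in its closure, a closed subgroup of finite index, hence open.
[cite: MochizukiSemiAnbd2006, Def 6.2(ii) p.70] -/
theorem isDOFType_of_finiteIndex (F : Subgroup P) [F.FiniteIndex] : IsDOFType F := by
  haveI : F.topologicalClosure.FiniteIndex :=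
    Subgroup.finiteIndex_of_le F.le_topologicalClosure
  refine ⟨F.topologicalClosure, ?_, inferInstance, ?_⟩
  · exact Subgroup.isOpen_of_isClosed_of_finiteIndex _ F.isClosed_topologicalClosure
  · rw [Subgroup.topologicalClosure_coe]

omit [IsTopologicalGroup P] in
/-- For a subgroup `F` dense in the open finite-index subgroup `U`, the closure of `ι(F)` in the
profinite completion is the closure `Û` of `ι(U)`. [cite: MochizukiSemiAnbd2006, Lem 6.3(iii) p.70] -/
theorem closure_image_eq_of_closure_eq {ι : P →ₜ* Ph} {F U : Subgroup P}
    (hcl : closure (F : Set P) = U) :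
    closure (ι '' (F : Set P)) = ((U.map ι.toMonoidHom).topologicalClosure : Set Ph) := by
  rw [Subgroup.topologicalClosure_coe, Subgroup.coe_map]
  have hFU : (F : Set P) ⊆ U := fun x hx => by rw [← hcl]; exact subset_closure hx
  apply le_antisymm (closure_mono (Set.image_mono hFU))
  refine closure_minimal ?_ isClosed_closure
  calc ι '' (U : Set P) = ι '' closure (F : Set P) := by rw [hcl]
    _ ⊆ closure (ι '' (F : Set P)) := image_closure_subset_closure_image ι.continuous

/-- **[SemiAnbd] Lemma 6.3 (iii) without the density hypothesis**, generic form over a tempered group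
`Π` with profinite completion `ι : Π → Π̂` and a good tower: if `F₁, F₂ ≤ Π` are of DOF-type and
`x ∈ Π̂` conjugates `ι(F₁)` onto `ι(F₂)`, then `x ∈ ι(Π)`.  (Move `x` into the open coset `x · Û₁` by
the density of `ι(Π)`, then apply the equal-closure case `mem_range_of_conj_eq_of_closure_eq`.)
[cite: MochizukiSemiAnbd2006, Lem 6.3(iii) p.70] -/
theorem IsTempered.mem_range_of_conj_eq_of_isDOFType (hP : IsTempered P) (ι : P →ₜ* Ph)
    (hι : IsProfiniteCompletion ι)
    (htower₀ : ∀ U ∈ 𝓝 (1 : P), ∃ N : OpenNormalSubgroup P, (N : Set P) ⊆ U ∧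
      ∃ (G : Subgroup (P ⧸ N.toSubgroup)) (_ : IsFreeGroup G), G.Normal ∧ G.FiniteIndex ∧
        Finite (IsFreeGroup.Generators G) ∧ ∃ a ∈ G, ∃ b ∈ G, a * b ≠ b * a)
    {F₁ F₂ : Subgroup P} (hF₁ : IsDOFType F₁) (hF₂ : IsDOFType F₂) (x : Ph)
    (hconj : ∀ a ∈ F₁, ∃ b ∈ F₂, x * ι a * x⁻¹ = ι b)
    (hconj' : ∀ b ∈ F₂, ∃ a ∈ F₁, x * ι a * x⁻¹ = ι b) :
    x ∈ ι.toMonoidHom.range := by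
  obtain ⟨U₁, hU₁o, hU₁fi, hcl₁⟩ := hF₁
  obtain ⟨U₂, hU₂o, hU₂fi, hcl₂⟩ := hF₂
  haveI := hU₁fi
  haveI := hU₂fi
  -- the open closures `Û₁`, `Û₂` in `Π̂`
  set W₁ : Subgroup Ph := (U₁.map ι.toMonoidHom).topologicalClosure with hW₁
  set W₂ : Subgroup Ph := (U₂.map ι.toMonoidHom).topologicalClosure with hW₂
  have hW₁o : IsOpen (W₁ : Set Ph) := IsProfiniteCompletion.isOpen_topologicalClosure_map hι U₁ hU₁o
  have hW₁cl : closure (ι '' (F₁ : Set P)) = (W₁ : Set Ph) := closure_image_eq_of_closure_eq hcl₁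
  have hW₂cl : closure (ι '' (F₂ : Set P)) = (W₂ : Set Ph) := closure_image_eq_of_closure_eq hcl₂
  -- `x · cl ι(F₁) · x⁻¹ = cl ι(F₂)`
  let c : Ph ≃ₜ Ph := (Homeomorph.mulLeft x).trans (Homeomorph.mulRight x⁻¹)
  have hc : ∀ z, c z = x * z * x⁻¹ := fun _ => rfl
  have himg : c '' (ι '' (F₁ : Set P)) = ι '' (F₂ : Set P) := by
    ext z
    constructor
    · rintro ⟨_, ⟨a, ha, rfl⟩, rfl⟩
      obtain ⟨b, hb, hab⟩ := hconj a ha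
      exact ⟨b, hb, by rw [hc, hab]⟩
    · rintro ⟨b, hb, rfl⟩
      obtain ⟨a, ha, hab⟩ := hconj' b hb
      exact ⟨ι a, ⟨a, ha, rfl⟩, by rw [hc, hab]⟩
  have hW : c '' (W₁ : Set Ph) = (W₂ : Set Ph) := by
    rw [← hW₁cl, ← hW₂cl, c.image_closure, himg]
  -- move `x` into `x · Û₁` by an element of `ι(Π)`: `x⁻¹ ι(p) ∈ Û₁`
  obtain ⟨p, hp⟩ := exists_inv_mul_mem_of_denseRange ι hι.denseRange hW₁o x
  -- `y := ι(p)⁻¹ x` conjugates `F₁` onto `p⁻¹ F₂ p`, both dense in `U₁`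
  set y : Ph := (ι p)⁻¹ * x with hy
  let F₂' : Subgroup P := F₂.map (MulAut.conj p⁻¹).toMonoidHom
  -- closure of `p⁻¹ F₂ p` is `p⁻¹ U₂ p = U₁`
  have hU₁W : U₁ = W₁.comap ι.toMonoidHom :=
    (IsProfiniteCompletion.comap_topologicalClosure_map hι U₁ hU₁o).symm
  have hU₂W : U₂ = W₂.comap ι.toMonoidHom :=
    (IsProfiniteCompletion.comap_topologicalClosure_map hι U₂ hU₂o).symm
  have hWconj : ∀ z, z ∈ W₁ ↔ x * z * x⁻¹ ∈ W₂ := fun z => by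
    rw [← SetLike.mem_coe, ← SetLike.mem_coe, ← hW, ← hc]
    exact (c.injective.mem_set_image).symm
  have hcl₂' : closure (F₂' : Set P) = U₁ := by
    let d : P ≃ₜ P := (Homeomorph.mulLeft p⁻¹).trans (Homeomorph.mulRight p⁻¹⁻¹)
    have hdF : (F₂' : Set P) = d '' (F₂ : Set P) := by
      ext z
      simp only [F₂', Subgroup.coe_map, Set.mem_image, SetLike.mem_coe]
      constructor
      · rintro ⟨b, hb, rfl⟩
        exact ⟨b, hb, rfl⟩
      · rintro ⟨b, hb, rfl⟩
        exact ⟨b, hb, rfl⟩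
    rw [hdF, ← d.image_closure, hcl₂]
    ext z
    constructor
    · rintro ⟨u, hu, rfl⟩
      change p⁻¹ * u * p⁻¹⁻¹ ∈ (U₁ : Set P)
      rw [inv_inv, SetLike.mem_coe, hU₁W, Subgroup.mem_comap]
      change ι (p⁻¹ * u * p) ∈ W₁
      rw [hWconj, map_mul, map_mul, map_inv]
      have hu' : ι u ∈ W₂ := by
        have := hu
        rw [SetLike.mem_coe, hU₂W] at this
        exact this
      -- `x ι(p)⁻¹ ι(u) ι(p) x⁻¹ = (x⁻¹ ι p)⁻¹ ... ` : conjugate of `ι u ∈ W₂` by `x (ι p)⁻¹ ∈ W₂`? use `w := x⁻¹ ι p ∈ W₁`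
      have hw : x * (ι p)⁻¹ = (x * (x⁻¹ * ι p) * x⁻¹)⁻¹ := by group
      have hw2 : x * (x⁻¹ * ι p) * x⁻¹ ∈ W₂ := (hWconj _).mp hp
      have e : x * ((ι p)⁻¹ * ι u * ι p) * x⁻¹ =
          (x * (x⁻¹ * ι p) * x⁻¹)⁻¹ * ι u * (x * (x⁻¹ * ι p) * x⁻¹) := by group
      rw [e]
      exact W₂.mul_mem (W₂.mul_mem (W₂.inv_mem hw2) hu') hw2
    · intro hz
      refine ⟨p * z * p⁻¹, ?_, by change p⁻¹ * (p * z * p⁻¹) * p⁻¹⁻¹ = z; group⟩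
      rw [SetLike.mem_coe, hU₂W, Subgroup.mem_comap]
      change ι (p * z * p⁻¹) ∈ W₂
      have hz' : ι z ∈ W₁ := by
        have := hz
        rw [SetLike.mem_coe, hU₁W] at this
        exact this
      -- `ι p ι z ι p⁻¹ = x (x⁻¹ ι p) ι z (x⁻¹ ι p)⁻¹ x⁻¹` with `x⁻¹ ι p ∈ W₁`
      have e : ι (p * z * p⁻¹) = x * ((x⁻¹ * ι p) * ι z * (x⁻¹ * ι p)⁻¹) * x⁻¹ := by
        rw [map_mul, map_mul, map_inv]
        group
      rw [e]
      exact (hWconj _).mp (W₁.mul_mem (W₁.mul_mem hp hz') (W₁.inv_mem hp))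
  have key : ∀ (a b : P), x * ι a * x⁻¹ = ι b → y * ι a * y⁻¹ = ι (p⁻¹ * b * p⁻¹⁻¹) := by
    intro a b hab
    calc y * ι a * y⁻¹ = (ι p)⁻¹ * (x * ι a * x⁻¹) * ι p := by rw [hy]; group
      _ = ι (p⁻¹ * b * p⁻¹⁻¹) := by rw [hab, inv_inv, map_mul, map_mul, map_inv]
  have hconjy : ∀ a ∈ F₁, ∃ b ∈ F₂', y * ι a * y⁻¹ = ι b := by
    intro a ha
    obtain ⟨b, hb, hab⟩ := hconj a ha
    exact ⟨p⁻¹ * b * p⁻¹⁻¹, ⟨b, hb, rfl⟩, key a b hab⟩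
  have hconjy' : ∀ b ∈ F₂', ∃ a ∈ F₁, y * ι a * y⁻¹ = ι b := by
    rintro _ ⟨b, hb, rfl⟩
    obtain ⟨a, ha, hab⟩ := hconj' b hb
    exact ⟨a, ha, key a b hab⟩
  have hymem : y ∈ ι.toMonoidHom.range :=
    hP.mem_range_of_conj_eq_of_closure_eq ι hι htower₀ hcl₁ hcl₂' y hconjy hconjy'
  obtain ⟨q, hq⟩ := hymem
  refine ⟨p * q, ?_⟩
  change ι (p * q) = x
  have hq' : ι q = (ι p)⁻¹ * x := hq
  rw [map_mul, hq', mul_inv_cancel_left]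

/-- **A tempered group with a virtually free tower is commensurably terminal in its profinite
completion**: `C_{Π̂}(ι Π) = ι Π` ([AbsAnab] Def. 0.1 (iii) terminology; the `Π`-clause of [IUTchI]
Prop. 2.4 (iii) "`Π^tp_X` is commensurably terminal in `Π̂_X`" in generic form), over a tempered `Π`
with profinite completion `ι : Π → Π̂` and cofinally many open normal `N` with `Π/N ⊇` a non-abelian
free normal subgroup of finite index and finite rank.  An element `x` of the commensurator conjugates
the finite-index subgroup `ι⁻¹(ιΠ ∩ x⁻¹·ιΠ·x)` of `Π` onto `ι⁻¹(ιΠ ∩ x·ιΠ·x⁻¹)`, so lies in `ι(Π)` by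
`mem_range_of_conj_eq_of_isDOFType`. [cite: MochizukiSemiAnbd2006, Lem 6.3(iii) p.70] -/
theorem IsTempered.isCommensurablyTerminal_range (hP : IsTempered P) (ι : P →ₜ* Ph)
    (hι : IsProfiniteCompletion ι)
    (htower₀ : ∀ U ∈ 𝓝 (1 : P), ∃ N : OpenNormalSubgroup P, (N : Set P) ⊆ U ∧
      ∃ (G : Subgroup (P ⧸ N.toSubgroup)) (_ : IsFreeGroup G), G.Normal ∧ G.FiniteIndex ∧
        Finite (IsFreeGroup.Generators G) ∧ ∃ a ∈ G, ∃ b ∈ G, a * b ≠ b * a) :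
    IsCommensurablyTerminal ι.toMonoidHom.range := by
  classical
  set R : Subgroup Ph := ι.toMonoidHom.range with hR
  refine ⟨le_antisymm ?_ ?_⟩
  swap
  · -- `ι Π ≤ C(ι Π)`
    intro z hz
    rw [Subgroup.Commensurable.commensurator_mem_iff]
    have : ConjAct.toConjAct z • R = R := by
      ext w
      rw [Subgroup.mem_pointwise_smul_iff_inv_smul_mem, ← map_inv, ConjAct.smul_def,
        ConjAct.ofConjAct_toConjAct, inv_inv]
      constructor
      · intro hw
        have := R.mul_mem (R.mul_mem hz hw) (R.inv_mem hz)
        simpa [mul_assoc] using this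
      · intro hw
        exact R.mul_mem (R.mul_mem (R.inv_mem hz) hw) hz
    simpa only [this] using Subgroup.Commensurable.refl R
  · intro x hx
    have hx' : x⁻¹ ∈ Subgroup.Commensurable.commensurator R := Subgroup.inv_mem _ hx
    rw [Subgroup.Commensurable.commensurator_mem_iff] at hx hx'
    -- `F₂ := ι⁻¹(x ιΠ x⁻¹ ∩ ιΠ)`, `F₁ := ι⁻¹(x⁻¹ ιΠ x ∩ ιΠ)`, both of finite index in `Π`
    let H₂ : Subgroup Ph := ConjAct.toConjAct x • R ⊓ R
    let H₁ : Subgroup Ph := ConjAct.toConjAct x⁻¹ • R ⊓ R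
    let F₂ : Subgroup P := H₂.comap ι.toMonoidHom
    let F₁ : Subgroup P := H₁.comap ι.toMonoidHom
    haveI : F₂.FiniteIndex := by
      refine ⟨?_⟩
      rw [Subgroup.index_comap, ← hR, Subgroup.inf_relIndex_right]
      exact hx.1
    haveI : F₁.FiniteIndex := by
      refine ⟨?_⟩
      rw [Subgroup.index_comap, ← hR, Subgroup.inf_relIndex_right]
      exact hx'.1
    have hmem₁ : ∀ a : P, a ∈ F₁ ↔ x * ι a * x⁻¹ ∈ R := by
      intro a
      change ι a ∈ H₁ ↔ _
      rw [Subgroup.mem_inf, Subgroup.mem_pointwise_smul_iff_inv_smul_mem, ← map_inv, inv_inv,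
        ConjAct.smul_def, ConjAct.ofConjAct_toConjAct]
      exact ⟨fun h => h.1, fun h => ⟨h, ⟨a, rfl⟩⟩⟩
    have hmem₂ : ∀ b : P, b ∈ F₂ ↔ x⁻¹ * ι b * x ∈ R := by
      intro b
      change ι b ∈ H₂ ↔ _
      rw [Subgroup.mem_inf, Subgroup.mem_pointwise_smul_iff_inv_smul_mem, ← map_inv,
        ConjAct.smul_def, ConjAct.ofConjAct_toConjAct, inv_inv]
      exact ⟨fun h => h.1, fun h => ⟨h, ⟨b, rfl⟩⟩⟩
    refine hP.mem_range_of_conj_eq_of_isDOFType ι hι htower₀ (isDOFType_of_finiteIndex F₁)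
      (isDOFType_of_finiteIndex F₂) x ?_ ?_
    · intro a ha
      obtain ⟨b, hb⟩ := (hmem₁ a).mp ha
      have hb' : ι b = x * ι a * x⁻¹ := hb
      refine ⟨b, (hmem₂ b).mpr ?_, hb'.symm⟩
      have e : x⁻¹ * ι b * x = ι a := by rw [hb']; group
      rw [e]
      exact ⟨a, rfl⟩
    · intro b hb
      obtain ⟨a, ha⟩ := (hmem₂ b).mp hb
      have ha' : ι a = x⁻¹ * ι b * x := ha
      have e : x * ι a * x⁻¹ = ι b := by rw [ha']; group
      refine ⟨a, (hmem₁ a).mpr ?_, e⟩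
      rw [e]
      exact ⟨b, rfl⟩

end Generic

namespace TemperedCurve

variable {p : ℕ} [Fact p.Prime]

/-- **`Π^temp_{X_K}` is commensurably terminal in `Π_{X_K}`** for a datum `X : TemperedCurve p` of
the [SemiAnbd] §6 interface (the `Π`-clause of [IUTchI] Prop. 2.4 (iii) in the §6 vocabulary;
sharpens Lemma 6.1 (iii) `X.PiTempNormallyTerminal`), modulo `IsTempered X.PiTemp` and the virtually
free tower input `htower₀` ([André 2003, §4.5]). [cite: MochizukiSemiAnbd2006, Lem 6.3(iii) p.70] -/
theorem isCommensurablyTerminal_range_toHat_of_tower (X : TemperedCurve p) (hT : IsTempered X.PiTemp)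
    (htower₀ : ∀ U ∈ 𝓝 (1 : X.PiTemp), ∃ N : OpenNormalSubgroup X.PiTemp, (N : Set X.PiTemp) ⊆ U ∧
      ∃ (G : Subgroup (X.PiTemp ⧸ N.toSubgroup)) (_ : IsFreeGroup G), G.Normal ∧ G.FiniteIndex ∧
        Finite (IsFreeGroup.Generators G) ∧ ∃ a ∈ G, ∃ b ∈ G, a * b ≠ b * a) :
    IsCommensurablyTerminal X.toHat.toMonoidHom.range :=
  hT.isCommensurablyTerminal_range X.toHat X.isProfiniteCompletion_toHat htower₀

end TemperedCurve

end Literature.AnabelianGeometry.SemiGraphs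

end
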